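import Summits.ABC.IUTFork.Conditional.AbcOfSHvolSplitHeight
import Summits.ABC.IUTFork.LDHGenuineHullRegimeSzpiroSlack
import Literature.IUT.LogVolume.WeightDescentExpectation
import HarnessLib

/-!
# The fork at [IUTchIII] Corollary 3.12, L-DH level, READING (U): the SLOT REGIME of a genuine Θ-volume datum READ ON THE
# POINT — datum-free transport of `logQloc`, of slot-constancy and of the mixed local-height sums from `F_mod(E_F) ⊆ F` to
# `ℚ(j(λ)) ⊆ F_tpd`; the (U)-hull estimate with print's `B_III` at every admissible `λ` whose bad primes do NOT split unevenly
# in `ℚ(j(λ))` (abc-iut cell, R2 S-chain team seat abc-iut-s2-p1; crux ThetaPartII = stmt-ABC-19678; CONE binder `hvol`/`hreg`)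

Record-only PROOF file (D-0012) of the abc-iut cell; TAKES NO SIDE on [IUTchIII] Cor. 3.12 or on the (U)/(P) readings of
"−|log(Θ)|". Mochizuki, *Inter-universal Teichmüller theory IV* (RIMS manuscript Apr. 2020 = PRIMS **57** (2021)), Thm. 1.10 proof
Steps (ii)–(v) pp. 24–29 (Step (v) p. 27–28: "`i†` to be `j`"), Cor. 2.2 (ii) proof p. 46 ((P5): `𝕍^bad_mod` = the places of `F_mod`
not dividing `2l` of bad multiplicative reduction); Dupuy–Hilado [DupuyHilado2025] §3.3, §3.6, §4.7.

THE POINT. abc-iut-S3's pinned junction `PointDict.hullEstimateOf_BIII_pinned` proves the (U)-hull estimate with print's `B_III` at a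
datum `T` that is SLOT-CONSTANT (`logQloc p v = logQloc p w` for all places `v, w` of the datum's `F_mod(E_F)` over each support
prime) — the regime clause of v4's `hreg`, stated ON THE DATUM. Following abc-iut-s2-p5's transport (`range_algebraMap_adjoin_jInv_eq`:
`ℚ(j(λ)) ⊆ F_tpd` and `F_mod(E_F)` have the same image in `F`; same image ⟹ same places, weights and normalised local heights
through a place of `F` above; badness read through the (P5) choice `T.isP5Choice`), this file reads the regime ON THE POINT:
for a place `V` of `F_mod := ℚ(j(λ)) = IntermediateField.adjoin ℚ {j(λ)} ⊆ F_tpd` put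
`h♭(V) := (−ord_V j(λ))·log N(V)/n_V` if `ord_V j(λ) < 0`, `V ∤ 2`, `V ∤ l` (a (P5)-bad place) and `h♭(V) := 0` otherwise
(spelled out inline; nothing is defined).

* `PointDict.finBelow_mem_badPrimesMod_iff` — for a place `x` of `F`: `x ∩ F_mod(E_F) ∈ 𝕍^bad_mod(T.D)` iff `x ∩ ℚ(j(λ))` is
  (P5)-bad (both halves of abc-iut-s2-p5's in-proof argument, as one `iff`);
* `PointDict.logQloc_finBelow_eq` — `logQloc(x ∩ F_mod(E_F)) = h♭(x ∩ ℚ(j(λ)))`;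
* `PointDict.slotConstant_of_point` — if `h♭` is constant on the places of `ℚ(j(λ))` over `p`, the datum is slot-constant at `p`;
  `PointDict.not_pointConstant_of_not_slotConstant` — contrapositive, the form the mixed sums use;
* `PointDict.sum_badHeight_weight_eq_point` — the `Pr`-weighted bad local-height sum over the places of `F_mod(E_F)` above `p`
  EQUALS the same sum over the places of `ℚ(j(λ))` above `p` (weight descent to `F` twice, abc-iut-S2's
  `sum_weight_mul_eq_of_fibreConst`);
* **`PointDict.hullVolumeAtDatum_BIII_of_pointSlotConstant`** — DATUM-FREE POSITIVE THEOREM: for `λ ∈ U_P` minimal, `l ≥ 7`, if at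
  every rational prime `p` the function `h♭` is constant on the places of `ℚ(j(λ))` above `p` (e.g. `d_mod = 1`; every bad prime
  `∤ 2l` inert or totally ramified in `ℚ(j(λ))`; or split with equal normalised `q`-orders), then `Cor22.HullVolumeAtDatum P l (B_III P l)`
  — the CONE binder `hvol` at `(P, l)` holds outright (abc-iut-S3's pinned junction + abc-iut-S1's (R4) `R4_towerFact`).

HONEST SCOPE: transport bookkeeping and a composition; no datum is constructed; no side taken on Cor. 3.12 / Thm. 1.10; typed ≠ proved.
PROOF-ONLY file: no definitions, no named `Prop` facts. [cite: Mochizuki2012, IUTchIV Thm. 1.10 proof Steps (ii)–(v) p. 24–29]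
[cite: Mochizuki2012, IUTchIV Cor. 2.2 (ii) proof p. 46] [cite: DupuyHilado2025, §3.3, §3.6, §4.7] [cite: NeukirchANT1999, Ch. I §8]
[claim: Mochizuki2012, status: disputed] for every IUT quotation.
-/

noncomputable section

namespace Summit.ABC.IUTFork

open NumberField IsDedekindDomain Literature.IUT.LogVolume Literature.IUT.HodgeTheaters
open Literature.NumberTheory.DiophantineGeometry.GenEll
open scoped Classical

namespace PointDict

variable {P : NFPoint} {l : ℕ}

/-- **Badness transported to the point.** For a genuine Θ-volume datum `T` at `(P, l)` and a place `x` of `F`: the place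
`x ∩ F_mod(E_F)` lies in `𝕍^bad_mod(T.D)` iff the place `x ∩ ℚ(j(λ))` of `ℚ(j(λ)) ⊆ F_tpd` has `ord(j(λ)) < 0` and divides
neither `2` nor `l` — the (P5) choice `T.isP5Choice` (bad multiplicative places not over `2l`), semistability of `E_F`
(`|j|_x ≤ 1` at good `x`, `ord_x j < 0` at multiplicative `x`) and `j(E_F) = j(λ)` in `F`. Both halves are abc-iut-s2-p5's
in-proof argument (`splitPair_le_of_hullVolumeAtDatum`). [cite: Mochizuki2012, IUTchIV Cor. 2.2 (ii) proof p. 46]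
[cite: Mochizuki2012, IUTchI Def. 3.1 (b) p. 61] [claim: Mochizuki2012, status: disputed] -/
theorem finBelow_mem_badPrimesMod_iff (T : Cor22.ThetaVolumeDatumAt P l)
    (x : @HeightOneSpectrum (@NumberField.RingOfIntegers T.F T.instFieldF) _) :
    (letI := T.instFieldF; letI := T.instNumberFieldF; letI := T.instAlgebraF; letI := T.instFieldK
     letI := T.instNumberFieldK; letI := T.instAlgebraK; letI := T.instFieldFbar; letI := T.instAlgebraFbar
     letI := T.instAlgebraKFbar; letI := T.instIsElliptic
     letI : Algebra ↥(IntermediateField.adjoin ℚ ({Cor22.jInv P.x} : Set P.F)) T.F :=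
       ((algebraMap P.F T.F).comp (algebraMap ↥(IntermediateField.adjoin ℚ ({Cor22.jInv P.x} : Set P.F)) P.F)).toAlgebra
     finBelow ↥(fieldOfModuli T.E) T.F x ∈ ThetaData.badPrimesMod T.D ↔
       (ord _ (finBelow ↥(IntermediateField.adjoin ℚ ({Cor22.jInv P.x} : Set P.F)) T.F x) (Cor22.jMod P) < 0 ∧
        ((2 : ℕ) : 𝓞 ↥(IntermediateField.adjoin ℚ ({Cor22.jInv P.x} : Set P.F))) ∉
          (finBelow ↥(IntermediateField.adjoin ℚ ({Cor22.jInv P.x} : Set P.F)) T.F x).asIdeal ∧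
        ((l : ℕ) : 𝓞 ↥(IntermediateField.adjoin ℚ ({Cor22.jInv P.x} : Set P.F))) ∉
          (finBelow ↥(IntermediateField.adjoin ℚ ({Cor22.jInv P.x} : Set P.F)) T.F x).asIdeal)) := by
  letI := T.instFieldF; letI := T.instNumberFieldF; letI := T.instAlgebraF; letI := T.instFieldK
  letI := T.instNumberFieldK; letI := T.instAlgebraK; letI := T.instFieldFbar; letI := T.instAlgebraFbar
  letI := T.instAlgebraKFbar; letI := T.instIsElliptic
  set Fm : Type := ↥(IntermediateField.adjoin ℚ ({Cor22.jInv P.x} : Set P.F)) with hFm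
  letI : Algebra Fm T.F := ((algebraMap P.F T.F).comp (algebraMap Fm P.F)).toAlgebra
  show finBelow ↥(fieldOfModuli T.E) T.F x ∈ ThetaData.badPrimesMod T.D ↔
    (ord Fm (finBelow Fm T.F x) (Cor22.jMod P) < 0 ∧ ((2 : ℕ) : 𝓞 Fm) ∉ (finBelow Fm T.F x).asIdeal ∧
      ((l : ℕ) : 𝓞 Fm) ∉ (finBelow Fm T.F x).asIdeal)
  have hjj : algebraMap Fm T.F (Cor22.jMod P) = algebraMap ↥(fieldOfModuli T.E) T.F (ThetaData.jMod T.E) := by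
    change algebraMap P.F T.F (algebraMap Fm P.F (Cor22.jMod P)) = T.E.j
    rw [T.j_eq]
    rfl
  have he : HeightOneSpectrum.under (𝓞 ↥(fieldOfModuli T.E)) x = finBelow ↥(fieldOfModuli T.E) T.F x :=
    HeightOneSpectrum.ext rfl
  constructor
  · intro hbad
    have hVF : FinitePlace.mk x ∈ T.D.VFbad := (ThetaData.mk_mem_VFbad_iff T.D x).mpr (by rw [he]; exact hbad)
    obtain ⟨hx2l, hmult⟩ := (T.isP5Choice (FinitePlace.mk x)).mp hVF
    rw [FinitePlace.maximalIdeal_mk] at hx2l hmult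
    have hordx : ord T.F x T.E.j < 0 := ThetaData.ord_j_neg_of_hasMultiplicativeReductionAt hmult
    refine ⟨?_, ?_, ?_⟩
    · rw [← Cor22.ord_algebraMap_neg_iff x (Cor22.jMod P), hjj]
      exact hordx
    · exact fun h2 => hx2l 2 (by simp) ((Cor22.natCast_mem_asIdeal_finBelow_iff x 2).mp h2)
    · exact fun hl => hx2l l (by simp) ((Cor22.natCast_mem_asIdeal_finBelow_iff x l).mp hl)
  · rintro ⟨hvj, hv2, hvl⟩
    have hordx : ord T.F x T.E.j < 0 := by
      rw [← Cor22.ord_algebraMap_neg_iff x (Cor22.jMod P), hjj] at hvj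
      exact hvj
    have hmult : T.E.HasMultiplicativeReductionAt x := by
      refine (T.D.isSemistable x).resolve_left fun hgood => ?_
      have hle : x.valuation T.F T.E.j ≤ 1 := valuation_j_le_one_of_hasGoodReduction_localMinimalModel x T.E hgood
      have h0 : 0 ≤ ord T.F x T.E.j := by
        unfold ord
        rw [neg_nonneg]
        by_cases hz : x.valuation T.F T.E.j = 0
        · simp [hz]
        · rw [← WithZero.log_one]
          exact (WithZero.log_le_log hz one_ne_zero).mpr hle
      omega
    have hx2l : ∀ q ∈ ({2, l} : Finset ℕ), ((q : ℕ) : 𝓞 T.F) ∉ x.asIdeal := by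
      intro q hq hmem
      have hmem' : ((q : ℕ) : 𝓞 Fm) ∈ (finBelow Fm T.F x).asIdeal :=
        (Cor22.natCast_mem_asIdeal_finBelow_iff x q).mpr hmem
      simp only [Finset.mem_insert, Finset.mem_singleton] at hq
      rcases hq with rfl | rfl
      · exact hv2 hmem'
      · exact hvl hmem'
    have hVF : FinitePlace.mk x ∈ T.D.VFbad :=
      (T.isP5Choice (FinitePlace.mk x)).mpr (by rw [FinitePlace.maximalIdeal_mk]; exact ⟨hx2l, hmult⟩)
    have h1 := (ThetaData.mk_mem_VFbad_iff T.D x).mp hVF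
    rwa [he] at h1

/-- **`logQloc` transported to the point.** For a genuine Θ-volume datum `T` at `(P, l)` and a place `x` of `F` over `p`:
`logQloc_p(x ∩ F_mod(E_F)) = h♭(x ∩ ℚ(j(λ)))`, where `logQloc_p(v) = 𝔮(v)·log N(v)/n_v` (abc-iut-c312-d1; `𝔮(v) = −ord_v(j_E)`
on `𝕍^bad_mod`, `0` elsewhere — Dupuy–Hilado §3.3) and `h♭(V) = (−ord_V j(λ))·log N(V)/n_V` at a (P5)-bad place `V` of `ℚ(j(λ))`,
`0` elsewhere. Badness by `finBelow_mem_badPrimesMod_iff`, the value by abc-iut-s2-p5's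
`ord_mul_logNorm_div_localDegree_finBelow_eq` (same image in `F`). [cite: DupuyHilado2025, §3.3, §3.6]
[cite: Mochizuki2012, IUTchIV Cor. 2.2 (ii) proof p. 46] [claim: Mochizuki2012, status: disputed] -/
theorem logQloc_finBelow_eq (T : Cor22.ThetaVolumeDatumAt P l) (p : ℕ) [Fact p.Prime]
    (x : @HeightOneSpectrum (@NumberField.RingOfIntegers T.F T.instFieldF) _)
    (hx : letI := T.instFieldF; letI := T.instNumberFieldF; x ∈ placesOver T.F p) :
    (letI := T.instFieldF; letI := T.instNumberFieldF; letI := T.instAlgebraF; letI := T.instFieldK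
     letI := T.instNumberFieldK; letI := T.instAlgebraK; letI := T.instFieldFbar; letI := T.instAlgebraFbar
     letI := T.instAlgebraKFbar; letI := T.instIsElliptic
     letI : Algebra ↥(IntermediateField.adjoin ℚ ({Cor22.jInv P.x} : Set P.F)) T.F :=
       ((algebraMap P.F T.F).comp (algebraMap ↥(IntermediateField.adjoin ℚ ({Cor22.jInv P.x} : Set P.F)) P.F)).toAlgebra
     (DHData.ofInput T.I).logQloc p ⟨finBelow ↥(fieldOfModuli T.E) T.F x, finBelow_mem_placesOver _ T.F hx⟩ =
       (if ord _ (finBelow ↥(IntermediateField.adjoin ℚ ({Cor22.jInv P.x} : Set P.F)) T.F x) (Cor22.jMod P) < 0 ∧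
            ((2 : ℕ) : 𝓞 ↥(IntermediateField.adjoin ℚ ({Cor22.jInv P.x} : Set P.F))) ∉
              (finBelow ↥(IntermediateField.adjoin ℚ ({Cor22.jInv P.x} : Set P.F)) T.F x).asIdeal ∧
            ((l : ℕ) : 𝓞 ↥(IntermediateField.adjoin ℚ ({Cor22.jInv P.x} : Set P.F))) ∉
              (finBelow ↥(IntermediateField.adjoin ℚ ({Cor22.jInv P.x} : Set P.F)) T.F x).asIdeal
        then ((-ord _ (finBelow ↥(IntermediateField.adjoin ℚ ({Cor22.jInv P.x} : Set P.F)) T.F x) (Cor22.jMod P) : ℤ) : ℝ) *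
            logNorm _ (finBelow ↥(IntermediateField.adjoin ℚ ({Cor22.jInv P.x} : Set P.F)) T.F x) /
              (localDegree _ (finBelow ↥(IntermediateField.adjoin ℚ ({Cor22.jInv P.x} : Set P.F)) T.F x) : ℝ)
        else 0)) := by
  letI := T.instFieldF; letI := T.instNumberFieldF; letI := T.instAlgebraF; letI := T.instFieldK
  letI := T.instNumberFieldK; letI := T.instAlgebraK; letI := T.instFieldFbar; letI := T.instAlgebraFbar
  letI := T.instAlgebraKFbar; letI := T.instIsElliptic
  set Fm : Type := ↥(IntermediateField.adjoin ℚ ({Cor22.jInv P.x} : Set P.F)) with hFm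
  letI : Algebra Fm T.F := ((algebraMap P.F T.F).comp (algebraMap Fm P.F)).toAlgebra
  have hjj : algebraMap Fm T.F (Cor22.jMod P) = algebraMap ↥(fieldOfModuli T.E) T.F (ThetaData.jMod T.E) := by
    change algebraMap P.F T.F (algebraMap Fm P.F (Cor22.jMod P)) = T.E.j
    rw [T.j_eq]
    rfl
  have hiff := finBelow_mem_badPrimesMod_iff T x
  set v' := finBelow ↥(fieldOfModuli T.E) T.F x with hv'
  -- `logQloc = 2l·μ_T` and `μ_T` in printed quantities (abc-iut-S7 `mu_eq`)
  have hμ := mu_eq T v'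
  have hl0 : (2 * (l : ℝ)) ≠ 0 := by
    have : (l : ℝ) ≠ 0 := by exact_mod_cast T.D.l_prime.ne_zero
    positivity
  have hXl : (T.I.X.l : ℝ) = (l : ℝ) := by exact_mod_cast T.isVolumeInputOf.l_eq
  have e2 : ∀ q L n : ℝ, 2 * (l : ℝ) * (1 / (2 * (l : ℝ)) * q * L / n) = q * L / n := fun q L n => by
    rw [show 2 * (l : ℝ) * (1 / (2 * (l : ℝ)) * q * L / n) = (2 * (l : ℝ)) / (2 * (l : ℝ)) * (q * L / n) by ring,
      div_self hl0, one_mul]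
  have hq : (DHData.ofInput T.I).logQloc p ⟨v', finBelow_mem_placesOver _ T.F hx⟩ =
      2 * (l : ℝ) * (T.I.X.qPilot v' * logNorm ↥(fieldOfModuli T.E) v' / (localDegree ↥(fieldOfModuli T.E) v' : ℝ)) := by
    simp only [DHData.logQloc, DHData.ofInput_X]
    rw [PilotData.qPilot_eq_smul, Finsupp.smul_apply, smul_eq_mul, hXl, e2]
  rw [hq, hμ]
  by_cases hbad : v' ∈ ThetaData.badPrimesMod T.D
  · rw [if_pos hbad, if_pos (hiff.mp hbad)]
    have key := ord_mul_logNorm_div_localDegree_finBelow_eq (A := Fm) (B := ↥(fieldOfModuli T.E)) hjj x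
    have e : ∀ a L n : ℝ, 2 * (l : ℝ) * (-a / (2 * (l : ℝ)) * L / n) = -(a * L / n) := fun a L n => by
      rw [show 2 * (l : ℝ) * (-a / (2 * (l : ℝ)) * L / n) = -(a * L / n) * ((2 * (l : ℝ)) / (2 * (l : ℝ))) by ring,
        div_self hl0, mul_one]
    push_cast
    rw [e, ← key]
    ring
  · rw [if_neg hbad, if_neg (fun h => hbad (hiff.mpr h)), mul_zero]

/-- **Point-constancy ⟹ datum slot-constancy.** For a genuine Θ-volume datum `T` at `(P, l)` and a prime `p`: if `h♭` takes
ONE value on the places of `ℚ(j(λ))` above `p`, then the datum's `logQloc` is constant on the places of `F_mod(E_F)` above `p`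
(every such place is cut out by a place of `F` above `p`, `PlaceSection.exists_under_eq`; then `logQloc_finBelow_eq`).
[cite: DupuyHilado2025, §3.3, §3.6] [cite: Mochizuki2012, IUTchIV Thm. 1.10 Step (v) p. 27–28] [claim: Mochizuki2012, status: disputed] -/
theorem slotConstant_of_point (T : Cor22.ThetaVolumeDatumAt P l) (p : ℕ) [Fact p.Prime]
    (hconst : ∀ V W : HeightOneSpectrum (𝓞 ↥(IntermediateField.adjoin ℚ ({Cor22.jInv P.x} : Set P.F))),
      V ∈ placesOver _ p → W ∈ placesOver _ p →
      (if ord _ V (Cor22.jMod P) < 0 ∧ ((2 : ℕ) : 𝓞 _) ∉ V.asIdeal ∧ ((l : ℕ) : 𝓞 _) ∉ V.asIdeal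
        then ((-ord _ V (Cor22.jMod P) : ℤ) : ℝ) * logNorm _ V / (localDegree _ V : ℝ) else 0) =
      (if ord _ W (Cor22.jMod P) < 0 ∧ ((2 : ℕ) : 𝓞 _) ∉ W.asIdeal ∧ ((l : ℕ) : 𝓞 _) ∉ W.asIdeal
        then ((-ord _ W (Cor22.jMod P) : ℤ) : ℝ) * logNorm _ W / (localDegree _ W : ℝ) else 0)) :
    (letI := T.instFieldF; letI := T.instNumberFieldF; letI := T.instAlgebraF; letI := T.instFieldK
     letI := T.instNumberFieldK; letI := T.instAlgebraK; letI := T.instFieldFbar; letI := T.instAlgebraFbar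
     letI := T.instAlgebraKFbar; letI := T.instIsElliptic
     ∀ v w : placesOver ↥(fieldOfModuli T.E) p,
       (DHData.ofInput T.I).logQloc p v = (DHData.ofInput T.I).logQloc p w) := by
  letI := T.instFieldF; letI := T.instNumberFieldF; letI := T.instAlgebraF; letI := T.instFieldK
  letI := T.instNumberFieldK; letI := T.instAlgebraK; letI := T.instFieldFbar; letI := T.instAlgebraFbar
  letI := T.instAlgebraKFbar; letI := T.instIsElliptic
  set Fm : Type := ↥(IntermediateField.adjoin ℚ ({Cor22.jInv P.x} : Set P.F)) with hFm
  letI : Algebra Fm T.F := ((algebraMap P.F T.F).comp (algebraMap Fm P.F)).toAlgebra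
  intro v w
  -- places `x | v`, `y | w` of `F`
  obtain ⟨x, hx⟩ := PlaceSection.exists_under_eq (F₀ := ↥(fieldOfModuli T.E)) (K := T.F) v.1
  obtain ⟨y, hy⟩ := PlaceSection.exists_under_eq (F₀ := ↥(fieldOfModuli T.E)) (K := T.F) w.1
  have hxv : finBelow ↥(fieldOfModuli T.E) T.F x = v.1 := HeightOneSpectrum.ext (by rw [← hx]; rfl)
  have hyw : finBelow ↥(fieldOfModuli T.E) T.F y = w.1 := HeightOneSpectrum.ext (by rw [← hy]; rfl)
  have hxp : x ∈ placesOver T.F p := by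
    rw [mem_placesOver_iff_residueChar] at ⊢
    rw [← residueChar_finBelow (F := ↥(fieldOfModuli T.E)), hxv]
    exact (mem_placesOver_iff_residueChar v.1).mp v.2
  have hyp : y ∈ placesOver T.F p := by
    rw [mem_placesOver_iff_residueChar] at ⊢
    rw [← residueChar_finBelow (F := ↥(fieldOfModuli T.E)), hyw]
    exact (mem_placesOver_iff_residueChar w.1).mp w.2
  have hv' : v = ⟨finBelow ↥(fieldOfModuli T.E) T.F x, finBelow_mem_placesOver _ T.F hxp⟩ := Subtype.ext hxv.symm
  have hw' : w = ⟨finBelow ↥(fieldOfModuli T.E) T.F y, finBelow_mem_placesOver _ T.F hyp⟩ := Subtype.ext hyw.symm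
  rw [hv', hw', logQloc_finBelow_eq T p x hxp, logQloc_finBelow_eq T p y hyp]
  exact hconst _ _ (finBelow_mem_placesOver Fm T.F hxp) (finBelow_mem_placesOver Fm T.F hyp)

/-- **Contrapositive, the form the mixed sums use**: if the datum is NOT slot-constant at `p` (some two places of
`F_mod(E_F)` above `p` have different `logQloc`), then `h♭` is NOT constant on the places of `ℚ(j(λ))` above `p` — the mixed
support primes of the datum are mixed primes of the point. [cite: DupuyHilado2025, §3.3, §3.6]
[cite: Mochizuki2012, IUTchIV Thm. 1.10 Step (v) p. 27–28] [claim: Mochizuki2012, status: disputed] -/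
theorem not_pointConstant_of_not_slotConstant (T : Cor22.ThetaVolumeDatumAt P l) (p : ℕ) [Fact p.Prime]
    (h : letI := T.instFieldF; letI := T.instNumberFieldF; letI := T.instAlgebraF; letI := T.instFieldK
      letI := T.instNumberFieldK; letI := T.instAlgebraK; letI := T.instFieldFbar; letI := T.instAlgebraFbar
      letI := T.instAlgebraKFbar; letI := T.instIsElliptic
      ¬ ∀ v w : placesOver ↥(fieldOfModuli T.E) p,
        (DHData.ofInput T.I).logQloc p v = (DHData.ofInput T.I).logQloc p w) :
    ¬ ∀ V W : HeightOneSpectrum (𝓞 ↥(IntermediateField.adjoin ℚ ({Cor22.jInv P.x} : Set P.F))),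
      V ∈ placesOver _ p → W ∈ placesOver _ p →
      (if ord _ V (Cor22.jMod P) < 0 ∧ ((2 : ℕ) : 𝓞 _) ∉ V.asIdeal ∧ ((l : ℕ) : 𝓞 _) ∉ V.asIdeal
        then ((-ord _ V (Cor22.jMod P) : ℤ) : ℝ) * logNorm _ V / (localDegree _ V : ℝ) else 0) =
      (if ord _ W (Cor22.jMod P) < 0 ∧ ((2 : ℕ) : 𝓞 _) ∉ W.asIdeal ∧ ((l : ℕ) : 𝓞 _) ∉ W.asIdeal
        then ((-ord _ W (Cor22.jMod P) : ℤ) : ℝ) * logNorm _ W / (localDegree _ W : ℝ) else 0) :=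
  fun hconst => h (slotConstant_of_point T p hconst)

/-- **The `Pr`-weighted bad local-height sum over the places above `p`: datum = point.** For a genuine Θ-volume datum `T` at
`(P, l)` and a prime `p`:
`Σ_{v | p, v ∈ 𝕍^bad_mod(T.D)} Pr(v)·(−ord_v(j_E))·log N(v)/n_v` (places of the datum's `F_mod(E_F)`)
`= Σ_{V | p, V (P5)-bad} Pr(V)·(−ord_V(j(λ)))·log N(V)/n_V` (places of the point's `ℚ(j(λ)) ⊆ F_tpd`) — both equal the
`Pr_F`-expectation over the places of `F` above `p` of the fibre-constant summand `logQloc` (abc-iut-S2's weight descent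
`sum_weight_mul_eq_of_fibreConst`, sections by `exists_section_placesOver`; pointwise `logQloc_finBelow_eq`).
[cite: DupuyHilado2025, §3.3, §3.6] [cite: NeukirchANT1999, Ch. I §8 Prop. (8.2)] [claim: Mochizuki2012, status: disputed] -/
theorem sum_badHeight_weight_eq_point (T : Cor22.ThetaVolumeDatumAt P l) (p : ℕ) [Fact p.Prime] :
    (letI := T.instFieldF; letI := T.instNumberFieldF; letI := T.instAlgebraF; letI := T.instFieldK
     letI := T.instNumberFieldK; letI := T.instAlgebraK; letI := T.instFieldFbar; letI := T.instAlgebraFbar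
     letI := T.instAlgebraKFbar; letI := T.instIsElliptic
     ∑ v : placesOver ↥(fieldOfModuli T.E) p,
        (if v.1 ∈ ThetaData.badPrimesMod T.D then
          weight ↥(fieldOfModuli T.E) v.1 * (((-ord ↥(fieldOfModuli T.E) v.1 (ThetaData.jMod T.E) : ℤ) : ℝ)
            * logNorm ↥(fieldOfModuli T.E) v.1 / (localDegree ↥(fieldOfModuli T.E) v.1 : ℝ))
         else 0)) =
      ∑ V : placesOver ↥(IntermediateField.adjoin ℚ ({Cor22.jInv P.x} : Set P.F)) p,
        (if ord _ V.1 (Cor22.jMod P) < 0 ∧ ((2 : ℕ) : 𝓞 _) ∉ V.1.asIdeal ∧ ((l : ℕ) : 𝓞 _) ∉ V.1.asIdeal then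
          weight _ V.1 * (((-ord _ V.1 (Cor22.jMod P) : ℤ) : ℝ) * logNorm _ V.1 / (localDegree _ V.1 : ℝ))
         else 0) := by
  letI := T.instFieldF; letI := T.instNumberFieldF; letI := T.instAlgebraF; letI := T.instFieldK
  letI := T.instNumberFieldK; letI := T.instAlgebraK; letI := T.instFieldFbar; letI := T.instAlgebraFbar
  letI := T.instAlgebraKFbar; letI := T.instIsElliptic
  set Fm : Type := ↥(IntermediateField.adjoin ℚ ({Cor22.jInv P.x} : Set P.F)) with hFm
  letI : Algebra Fm T.F := ((algebraMap P.F T.F).comp (algebraMap Fm P.F)).toAlgebra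
  set FE : Type := ↥(fieldOfModuli T.E) with hFE
  -- the fibre-constant summand on the places of `F` above `p`
  set f : placesOver T.F p → ℝ := fun x =>
    (DHData.ofInput T.I).logQloc p ⟨finBelow FE T.F x.1, finBelow_mem_placesOver FE T.F x.2⟩ with hf
  have hfib : ∀ x x' : placesOver T.F p, finBelow FE T.F x.1 = finBelow FE T.F x'.1 → f x = f x' := by
    intro x x' h
    simp only [hf, h]
  -- sections of `V(F)_p → V(F_mod(E_F))_p` and `V(F)_p → V(ℚ(j(λ)))_p`
  obtain ⟨sE, hsE⟩ := exists_section_placesOver FE T.F p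
  obtain ⟨sP, hsP⟩ := exists_section_placesOver Fm T.F p
  -- datum side = expectation over `F`
  have hE : ∑ v : placesOver FE p,
      (if v.1 ∈ ThetaData.badPrimesMod T.D then
        weight FE v.1 * (((-ord FE v.1 (ThetaData.jMod T.E) : ℤ) : ℝ) * logNorm FE v.1 / (localDegree FE v.1 : ℝ))
       else 0) = ∑ x : placesOver T.F p, weight T.F x.1 * f x := by
    rw [sum_weight_mul_eq_of_fibreConst FE T.F f sE hsE hfib]
    refine Finset.sum_congr rfl fun v _ => ?_
    have hv : f (sE v) = (DHData.ofInput T.I).logQloc p v := by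
      simp only [hf]
      congr 1
      exact Subtype.ext (hsE v)
    rw [hv]
    -- `logQloc p v` in printed quantities: through a place of `F` above `v`
    obtain ⟨x, hx⟩ := PlaceSection.exists_under_eq (F₀ := FE) (K := T.F) v.1
    have hxv : finBelow FE T.F x = v.1 := HeightOneSpectrum.ext (by rw [← hx]; rfl)
    have hxp : x ∈ placesOver T.F p := by
      rw [mem_placesOver_iff_residueChar] at ⊢
      rw [← residueChar_finBelow (F := FE), hxv]
      exact (mem_placesOver_iff_residueChar v.1).mp v.2
    have hv' : v = ⟨finBelow FE T.F x, finBelow_mem_placesOver _ T.F hxp⟩ := Subtype.ext hxv.symm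
    have hq := logQloc_finBelow_eq T p x hxp
    have hiff := finBelow_mem_badPrimesMod_iff T x
    rw [hv', hq]
    by_cases hb : finBelow FE T.F x ∈ ThetaData.badPrimesMod T.D
    · rw [if_pos hb, if_pos (hiff.mp hb)]
      have key := ord_mul_logNorm_div_localDegree_finBelow_eq (A := Fm) (B := FE) (K := T.F)
        (a := Cor22.jMod P) (b := ThetaData.jMod T.E) (by
          change algebraMap P.F T.F (algebraMap Fm P.F (Cor22.jMod P)) = T.E.j
          rw [T.j_eq]; rfl) x
      have hw : weight FE (finBelow FE T.F x) = weight Fm (finBelow Fm T.F x) :=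
        (weight_finBelow_eq_of_range_eq (range_algebraMap_adjoin_jInv_eq T) x hxp).symm
      push_cast at key ⊢
      rw [hw, neg_mul, neg_mul, neg_div, neg_div, key]
    · rw [if_neg hb, if_neg (fun h => hb (hiff.mpr h)), mul_zero]
  -- point side = the same expectation over `F`
  have hP' : ∑ V : placesOver Fm p,
      (if ord Fm V.1 (Cor22.jMod P) < 0 ∧ ((2 : ℕ) : 𝓞 Fm) ∉ V.1.asIdeal ∧ ((l : ℕ) : 𝓞 Fm) ∉ V.1.asIdeal then
        weight Fm V.1 * (((-ord Fm V.1 (Cor22.jMod P) : ℤ) : ℝ) * logNorm Fm V.1 / (localDegree Fm V.1 : ℝ))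
       else 0) = ∑ x : placesOver T.F p, weight T.F x.1 * f x := by
    rw [sum_weight_mul_eq_of_fibreConst Fm T.F f sP hsP (fun x x' h => hfib x x'
      ((finBelow_eq_iff_of_range_eq (range_algebraMap_adjoin_jInv_eq T) x.1 x'.1).mp h))]
    refine Finset.sum_congr rfl fun V _ => ?_
    have hq := logQloc_finBelow_eq T p (sP V).1 (sP V).2
    simp only [hf]
    rw [hq, hsP V]
    split_ifs <;> ring
  rw [hE, hP']

/-- **DATUM-FREE POSITIVE THEOREM: the (U)-hull estimate with print's `B_III` at every admissible `λ` whose (P5)-bad local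
heights do not split unevenly in `ℚ(j(λ))`.** For `λ ∈ U_P` (minimally presented) and `l ≥ 7`: if for every rational prime `p`
the function `h♭` (`= (−ord_V j(λ))·log N(V)/n_V` at the places `V ∤ 2l` of `ℚ(j(λ))` with `ord_V j(λ) < 0`, `0` at the other
places) is CONSTANT on the places of `ℚ(j(λ))` above `p`, then `Cor22.HullVolumeAtDatum P l (B_III P l)` — the CONE binder `hvol`
of `abc_of_S_v3` at `(P, l)` holds outright. Covers `d_mod = 1` (one place over each `p`), every `λ` whose bad primes `∤ 2l` are
inert or totally ramified in `ℚ(j(λ))`, and uneven-free splittings. Composition: abc-iut-S3's `hullEstimateOf_BIII_pinned`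
([IUTchIV] Thm. 1.10 Steps (ii)–(v) at slot-constant data), abc-iut-S1's (R4) `R4_towerFact`, and `slotConstant_of_point`.
[cite: Mochizuki2012, IUTchIV Thm. 1.10 proof Steps (ii)–(v) p. 24–29] [claim: Mochizuki2012, status: disputed] -/
theorem hullVolumeAtDatum_BIII_of_pointSlotConstant (hP : P ∈ UP) (h7 : 7 ≤ l)
    (hconst : ∀ (p : ℕ), p.Prime → ∀ V W : HeightOneSpectrum (𝓞 ↥(IntermediateField.adjoin ℚ ({Cor22.jInv P.x} : Set P.F))),
      V ∈ placesOver _ p → W ∈ placesOver _ p →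
      (if ord _ V (Cor22.jMod P) < 0 ∧ ((2 : ℕ) : 𝓞 _) ∉ V.asIdeal ∧ ((l : ℕ) : 𝓞 _) ∉ V.asIdeal
        then ((-ord _ V (Cor22.jMod P) : ℤ) : ℝ) * logNorm _ V / (localDegree _ V : ℝ) else 0) =
      (if ord _ W (Cor22.jMod P) < 0 ∧ ((2 : ℕ) : 𝓞 _) ∉ W.asIdeal ∧ ((l : ℕ) : 𝓞 _) ∉ W.asIdeal
        then ((-ord _ W (Cor22.jMod P) : ℤ) : ℝ) * logNorm _ W / (localDegree _ W : ℝ) else 0)) :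
    Cor22.HullVolumeAtDatum P l (((l : ℝ) + 1) / 4 * ((1 + 12 * (Cor22.dmod P : ℝ) / l)
      * (P.logDiff + Cor22.logCondAvoid P {2, l}) + 2 * Real.log l + 52
        + 20 / 3 * Real.log (((2 ^ 12 * 3 ^ 3 * 5 * Cor22.dmod P : ℕ) : ℝ) * (l : ℝ))
          * (Nat.primeCounting (2 ^ 12 * 3 ^ 3 * 5 * Cor22.dmod P * l) : ℝ))) := by
  intro T
  letI := T.instFieldF; letI := T.instNumberFieldF; letI := T.instAlgebraF; letI := T.instFieldK
  letI := T.instNumberFieldK; letI := T.instAlgebraK; letI := T.instFieldFbar; letI := T.instAlgebraFbar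
  letI := T.instAlgebraKFbar; letI := T.instIsElliptic
  refine hullEstimateOf_BIII_pinned T hP h7 (T.R4_towerFact hP) ?_
  intro p hp v w
  haveI : Fact p.Prime := ⟨T.I.prime_of_mem_supportPrimes hp⟩
  exact slotConstant_of_point T p (hconst p (T.I.prime_of_mem_supportPrimes hp)) v w

end PointDict

end Summit.ABC.IUTFork

end
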